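import Summits.AtomisticToContinuum.FouriersLaw.Theorems.BondHeatUncertaintyBoundedResponseBathHeatTwistA
import HarnessLib

/-!
# BondHeatUncertainty / BoundedResponse — «DCBand» addendum «Twist», part B (§T2b–§T3): cross moments, boundary moments, the expansion

§T2b: the `cos`/`sin` CROSS path moment of two observables of opposite momentum parity reduces to a LAG integral
`2∫₀ᵗ(t − r)sin(ωr)⟪f,P_r g⟫dr` (odd cross-correlation); the final-value and initial-value × weighted-time-integral moments
`E[k(z_t)∫₀ᵗc(s)f(z_s)ds] = ∫₀ᵗc(s)⟪f,P_{t−s}k⟫ds`, `E[k(z_0)∫₀ᵗc(s)f(z_s)ds] = ∫₀ᵗc(s)⟪k,P_s f⟫ds`.  §T3: the expansion of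
`E[(A + ωC + (c_wE − E₀))² + (B − ωD + s_wE)²]` into fifteen path moments.
(decomp-a2c lens-1 g117, NODE 117 «DCBand» addendum; part 2 of 4; imports part A `…BathHeatTwistA`)

No `sorry`, no new axioms, no new definitions.
-/

noncomputable section

open MeasureTheory ProbabilityTheory Filter Topology Set Function
open scoped NNReal ENNReal
open Literature.MathematicalPhysics.KineticTheory.HeatConduction
open Literature.MathematicalPhysics.KineticTheory OscillatorChain
open Literature.Probability.Process
open Summit.AtomisticToContinuum.FouriersLaw.Theorems.SubdiffusiveBondHeat
open Summit.AtomisticToContinuum.FouriersLaw.Theorems.SubdiffusiveBondHeat.EscapeGrading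
open Summit.AtomisticToContinuum.FouriersLaw.Theorems.OddSectorIrreversibility

namespace Summit.AtomisticToContinuum.FouriersLaw.Theorems.BoundedResponse.HeatSpreading

open Summit.AtomisticToContinuum.FouriersLaw.Theses.BondHeatUncertainty (BoundedResponse SubdiffusiveBondHeat)

section PathMoments

variable {ω₂ lam β γ : ℝ} (hω : 0 < ω₂) (hl : 0 < lam) (hβ : 0 < β) (hγ : 0 < γ) {N : ℕ} (hN : 1 < N)
  {T : ℝ} (hT : 0 < T)
include hω hl hβ hγ hN hT

/-- **The `cos`/`sin` CROSS moment of two observables of opposite parity** (`⟪g, P_r f⟫ = −⟪f, P_r g⟫`, e.g. `f` momentum-odd and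
`g` momentum-even): `E[(∫₀ᵗcos(ωs)f(z_s))(∫₀ᵗsin(ωs)g(z_s))] − E[(∫₀ᵗsin(ωs)f(z_s))(∫₀ᵗcos(ωs)g(z_s))] = 2∫₀ᵗ (t − r) sin(ωr)⟪f,P_r g⟫ dr`
(the cross-correlation is ODD in the lag, so `sin(ω(v − u))C_{fg}(u,v)` is a lag function; square-to-lag reduction). [folklore] -/
theorem pinnedChain_integral_cos_sin_cross_eq {f g : PhaseSpace N → ℝ} (hfm : Measurable f) (hgm : Measurable g)
    (hf2 : Integrable (fun y => f y ^ 2) ((pinnedChain ω₂ lam β γ).gibbsMeasure N T))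
    (hg2 : Integrable (fun y => g y ^ 2) ((pinnedChain ω₂ lam β γ).gibbsMeasure N T))
    (hpar : ∀ r, kpair ω₂ lam β γ T N g f r = -kpair ω₂ lam β γ T N f g r) (ω : ℝ) {t : ℝ} (ht : 0 ≤ t) :
    (∫ p, (∫ s in (0 : ℝ)..t, Real.cos (ω * s) * f ((pinnedChain ω₂ lam β γ).solMap N T T s p.1 (pairPath p.2))) *
        (∫ s in (0 : ℝ)..t, Real.sin (ω * s) * g ((pinnedChain ω₂ lam β γ).solMap N T T s p.1 (pairPath p.2)))
        ∂(((pinnedChain ω₂ lam β γ).gibbsMeasure N T).prod wienerPair)) -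
      ∫ p, (∫ s in (0 : ℝ)..t, Real.sin (ω * s) * f ((pinnedChain ω₂ lam β γ).solMap N T T s p.1 (pairPath p.2))) *
        (∫ s in (0 : ℝ)..t, Real.cos (ω * s) * g ((pinnedChain ω₂ lam β γ).solMap N T T s p.1 (pairPath p.2)))
        ∂(((pinnedChain ω₂ lam β γ).gibbsMeasure N T).prod wienerPair) =
      2 * ∫ r in (0 : ℝ)..t, (t - r) * (Real.sin (ω * r) * kpair ω₂ lam β γ T N f g r) := by
  have hcm : Measurable fun s : ℝ => Real.cos (ω * s) := by fun_prop
  have hsm : Measurable fun s : ℝ => Real.sin (ω * s) := by fun_prop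
  have hcb : ∀ s : ℝ, |Real.cos (ω * s)| ≤ 1 := fun s => Real.abs_cos_le_one _
  have hsb : ∀ s : ℝ, |Real.sin (ω * s)| ≤ 1 := fun s => Real.abs_sin_le_one _
  rw [pinnedChain_integral_weightedIntegral_mul_eq hω hl hβ hγ hN hT hfm hgm hf2 hg2 hcm hsm hcb hsb ht,
    pinnedChain_integral_weightedIntegral_mul_eq hω hl hβ hγ hN hT hfm hgm hf2 hg2 hsm hcm hsb hcb ht]
  -- the two-time law kernel on the square: measurable and bounded
  set B : ℝ := (∫ y, f y ^ 2 ∂((pinnedChain ω₂ lam β γ).gibbsMeasure N T)) +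
    ∫ y, g y ^ 2 ∂((pinnedChain ω₂ lam β γ).gibbsMeasure N T) with hB
  have hKfg := measurable_kpair hω hl hβ hγ hT hfm hgm
  have hKgf := measurable_kpair hω hl hβ hγ hT hgm hfm
  have hKfgb := abs_kpair_le hω hl hβ hγ hN hT hfm hgm hf2 hg2
  have hKgfb : ∀ u, |kpair ω₂ lam β γ T N g f u| ≤ B := by
    intro u
    have h := abs_kpair_le hω hl hβ hγ hN hT hgm hfm hg2 hf2 u
    rw [hB]
    linarith
  have hCm : Measurable fun z : ℝ × ℝ =>
      (if z.1 < z.2 then kpair ω₂ lam β γ T N f g (z.2 - z.1) else kpair ω₂ lam β γ T N g f (z.1 - z.2)) :=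
    Measurable.ite (measurableSet_lt measurable_fst measurable_snd) (hKfg.comp (measurable_snd.sub measurable_fst))
      (hKgf.comp (measurable_fst.sub measurable_snd))
  have hCb : ∀ z : ℝ × ℝ,
      |(if z.1 < z.2 then kpair ω₂ lam β γ T N f g (z.2 - z.1) else kpair ω₂ lam β γ T N g f (z.1 - z.2))| ≤ B := by
    intro z
    split_ifs
    · exact hKfgb _
    · exact hKgfb _
  have hfin : ((volume : Measure ℝ).prod volume) (Ioc (0 : ℝ) t ×ˢ Ioc (0 : ℝ) t) < ∞ := by
    rw [Measure.prod_prod]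
    exact ENNReal.mul_lt_top measure_Ioc_lt_top measure_Ioc_lt_top
  have hInt : ∀ {a b : ℝ → ℝ}, Measurable a → Measurable b → (∀ s, |a s| ≤ 1) → (∀ s, |b s| ≤ 1) →
      IntegrableOn (fun z : ℝ × ℝ => a z.1 * b z.2 *
        (if z.1 < z.2 then kpair ω₂ lam β γ T N f g (z.2 - z.1) else kpair ω₂ lam β γ T N g f (z.1 - z.2)))
        (Ioc (0 : ℝ) t ×ˢ Ioc (0 : ℝ) t) (volume.prod volume) := by
    intro a b ha hb hab hbb
    refine IntegrableOn.of_bound hfin (((ha.comp measurable_fst).mul (hb.comp measurable_snd)).mul hCm).aestronglyMeasurable B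
      (Eventually.of_forall fun z => ?_)
    rw [Real.norm_eq_abs, abs_mul, abs_mul]
    have hB0 : 0 ≤ B := (abs_nonneg _).trans (hCb z)
    calc |a z.1| * |b z.2| * |(if z.1 < z.2 then kpair ω₂ lam β γ T N f g (z.2 - z.1) else kpair ω₂ lam β γ T N g f (z.1 - z.2))|
        ≤ 1 * 1 * B := by
          gcongr
          · exact hab z.1
          · exact hbb z.2
          · exact hCb z
      _ = B := by ring
  rw [← integral_sub (hInt hcm hsm hcb hsb) (hInt hsm hcm hsb hcb)]
  -- the difference is a LAG function
  have hlag : ∀ z ∈ Ioc (0 : ℝ) t ×ˢ Ioc (0 : ℝ) t,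
      Real.cos (ω * z.1) * Real.sin (ω * z.2) *
            (if z.1 < z.2 then kpair ω₂ lam β γ T N f g (z.2 - z.1) else kpair ω₂ lam β γ T N g f (z.1 - z.2)) -
          Real.sin (ω * z.1) * Real.cos (ω * z.2) *
            (if z.1 < z.2 then kpair ω₂ lam β γ T N f g (z.2 - z.1) else kpair ω₂ lam β γ T N g f (z.1 - z.2)) =
        if z.1 < z.2 then Real.sin (ω * (z.2 - z.1)) * kpair ω₂ lam β γ T N f g (z.2 - z.1)
          else Real.sin (ω * (z.1 - z.2)) * kpair ω₂ lam β γ T N f g (z.1 - z.2) := by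
    intro z _
    by_cases hlt : z.1 < z.2
    · simp only [if_pos hlt]
      rw [mul_sub, Real.sin_sub]
      ring
    · simp only [if_neg hlt]
      rw [hpar, mul_sub, Real.sin_sub]
      ring
  rw [setIntegral_congr_fun (measurableSet_Ioc.prod measurableSet_Ioc) hlag]
  -- square-to-lag reduction
  have ham : Measurable fun r : ℝ => Real.sin (ω * r) * kpair ω₂ lam β γ T N f g r := hsm.mul hKfg
  have haB : ∀ r : ℝ, |Real.sin (ω * r) * kpair ω₂ lam β γ T N f g r| ≤ B := by
    intro r
    rw [abs_mul]
    calc |Real.sin (ω * r)| * |kpair ω₂ lam β γ T N f g r| ≤ 1 * B := by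
          gcongr
          · exact hsb r
          · exact hKfgb r
      _ = B := by ring
  rw [setIntegral_square_lag_eq ham ham haB haB ht, ← intervalIntegral.integral_const_mul]
  exact intervalIntegral.integral_congr fun r _ => by ring

/-- Integrability of `k(z_r) ∫₀ᵗ c(s) f(z_s) ds` (`f, k ∈ L²(μ_T)`, `|c| ≤ 1` measurable, `t ≥ 0`). [folklore] -/
theorem pinnedChain_integrable_mul_weightedIntegral {f k : PhaseSpace N → ℝ} (hfm : Measurable f) (hkm : Measurable k)
    (hf2 : Integrable (fun y => f y ^ 2) ((pinnedChain ω₂ lam β γ).gibbsMeasure N T))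
    (hk2 : Integrable (fun y => k y ^ 2) ((pinnedChain ω₂ lam β γ).gibbsMeasure N T))
    {c : ℝ → ℝ} (hc : Measurable c) (hcb : ∀ s, |c s| ≤ 1) (r : ℝ) {t : ℝ} (ht : 0 ≤ t) :
    Integrable (fun p : PhaseSpace N × WienerPair =>
      k ((pinnedChain ω₂ lam β γ).solMap N T T r p.1 (pairPath p.2)) *
        (∫ s in (0 : ℝ)..t, c s * f ((pinnedChain ω₂ lam β γ).solMap N T T s p.1 (pairPath p.2))))
      (((pinnedChain ω₂ lam β γ).gibbsMeasure N T).prod wienerPair) := by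
  haveI := pinnedChain_isProbabilityMeasure_gibbsMeasure hω hl.le hβ.le γ N hT
  have hinv := pinnedChain_hinv_T hω hl hβ hγ hN hT
  have hZ := pinnedChain_measurable_solMap_process hω hl.le hβ.le hγ.le N T T
  have hGi := pinnedChain_integrable_uncurry_pointTime_of_invariant hω hl.le hβ.le hγ.le N T T _ hinv hfm hkm hf2 hk2 r t
  have hWm : Measurable (Function.uncurry fun (p : PhaseSpace N × WienerPair) (s : ℝ) =>
      k ((pinnedChain ω₂ lam β γ).solMap N T T r p.1 (pairPath p.2)) *
        (c s * f ((pinnedChain ω₂ lam β γ).solMap N T T s p.1 (pairPath p.2)))) := by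
    have h1 : Measurable fun w : (PhaseSpace N × WienerPair) × ℝ => (r, w.1) := measurable_const.prodMk measurable_fst
    have h2 : Measurable fun w : (PhaseSpace N × WienerPair) × ℝ => (w.2, w.1) := measurable_snd.prodMk measurable_fst
    have hA := hkm.comp (hZ.comp h1)
    have hB := hfm.comp (hZ.comp h2)
    have hc' : Measurable fun w : (PhaseSpace N × WienerPair) × ℝ => c w.2 := hc.comp measurable_snd
    exact hA.mul (hc'.mul hB)
  have hWi : Integrable (Function.uncurry fun (p : PhaseSpace N × WienerPair) (s : ℝ) =>
      k ((pinnedChain ω₂ lam β γ).solMap N T T r p.1 (pairPath p.2)) *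
        (c s * f ((pinnedChain ω₂ lam β γ).solMap N T T s p.1 (pairPath p.2))))
      ((((pinnedChain ω₂ lam β γ).gibbsMeasure N T).prod wienerPair).prod ((volume : Measure ℝ).restrict (Ioc 0 t))) := by
    refine hGi.mono hWm.aestronglyMeasurable (Eventually.of_forall fun w => ?_)
    simp only [Function.uncurry, Real.norm_eq_abs, abs_mul]
    have h1 := hcb w.2
    have hA := abs_nonneg (k ((pinnedChain ω₂ lam β γ).solMap N T T r w.1.1 (pairPath w.1.2)))
    have hB := abs_nonneg (f ((pinnedChain ω₂ lam β γ).solMap N T T w.2 w.1.1 (pairPath w.1.2)))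
    calc |k ((pinnedChain ω₂ lam β γ).solMap N T T r w.1.1 (pairPath w.1.2))| *
          (|c w.2| * |f ((pinnedChain ω₂ lam β γ).solMap N T T w.2 w.1.1 (pairPath w.1.2))|)
        ≤ |k ((pinnedChain ω₂ lam β γ).solMap N T T r w.1.1 (pairPath w.1.2))| *
          (1 * |f ((pinnedChain ω₂ lam β γ).solMap N T T w.2 w.1.1 (pairPath w.1.2))|) := by
          gcongr
      _ = _ := by ring
  refine hWi.integral_prod_left.congr (Eventually.of_forall fun p => ?_)
  simp only [Function.uncurry]
  rw [intervalIntegral.integral_of_le ht, ← MeasureTheory.integral_const_mul]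

/-- **Weighted end-point correlation, final value**: `E[k(z_t) ∫₀ᵗ c(s) f(z_s) ds] = ∫₀ᵗ c(s) ⟪f, P_{t−s} k⟫ ds`. [folklore] -/
theorem pinnedChain_integral_final_mul_weightedIntegral_eq {f k : PhaseSpace N → ℝ} (hfm : Measurable f) (hkm : Measurable k)
    (hf2 : Integrable (fun y => f y ^ 2) ((pinnedChain ω₂ lam β γ).gibbsMeasure N T))
    (hk2 : Integrable (fun y => k y ^ 2) ((pinnedChain ω₂ lam β γ).gibbsMeasure N T))
    {c : ℝ → ℝ} (hc : Measurable c) (hcb : ∀ s, |c s| ≤ 1) {t : ℝ} (ht : 0 ≤ t) :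
    ∫ p, k ((pinnedChain ω₂ lam β γ).solMap N T T t p.1 (pairPath p.2)) *
        (∫ s in (0 : ℝ)..t, c s * f ((pinnedChain ω₂ lam β γ).solMap N T T s p.1 (pairPath p.2)))
        ∂(((pinnedChain ω₂ lam β γ).gibbsMeasure N T).prod wienerPair) =
      ∫ s in (0 : ℝ)..t, c s * kpair ω₂ lam β γ T N f k (t - s) := by
  haveI := pinnedChain_isProbabilityMeasure_gibbsMeasure hω hl.le hβ.le γ N hT
  have hinv := pinnedChain_hinv_T hω hl hβ hγ hN hT
  have hZ := pinnedChain_measurable_solMap_process hω hl.le hβ.le hγ.le N T T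
  have hGi := pinnedChain_integrable_uncurry_pointTime_of_invariant hω hl.le hβ.le hγ.le N T T _ hinv hfm hkm hf2 hk2 t t
  have hWm : Measurable (Function.uncurry fun (p : PhaseSpace N × WienerPair) (s : ℝ) =>
      k ((pinnedChain ω₂ lam β γ).solMap N T T t p.1 (pairPath p.2)) *
        (c s * f ((pinnedChain ω₂ lam β γ).solMap N T T s p.1 (pairPath p.2)))) := by
    have h1 : Measurable fun w : (PhaseSpace N × WienerPair) × ℝ => (t, w.1) := measurable_const.prodMk measurable_fst
    have h2 : Measurable fun w : (PhaseSpace N × WienerPair) × ℝ => (w.2, w.1) := measurable_snd.prodMk measurable_fst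
    have hA := hkm.comp (hZ.comp h1)
    have hB := hfm.comp (hZ.comp h2)
    have hc' : Measurable fun w : (PhaseSpace N × WienerPair) × ℝ => c w.2 := hc.comp measurable_snd
    exact hA.mul (hc'.mul hB)
  have hWi : Integrable (Function.uncurry fun (p : PhaseSpace N × WienerPair) (s : ℝ) =>
      k ((pinnedChain ω₂ lam β γ).solMap N T T t p.1 (pairPath p.2)) *
        (c s * f ((pinnedChain ω₂ lam β γ).solMap N T T s p.1 (pairPath p.2))))
      ((((pinnedChain ω₂ lam β γ).gibbsMeasure N T).prod wienerPair).prod ((volume : Measure ℝ).restrict (Ioc 0 t))) := by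
    refine hGi.mono hWm.aestronglyMeasurable (Eventually.of_forall fun w => ?_)
    simp only [Function.uncurry, Real.norm_eq_abs, abs_mul]
    have h1 := hcb w.2
    have hA := abs_nonneg (k ((pinnedChain ω₂ lam β γ).solMap N T T t w.1.1 (pairPath w.1.2)))
    have hB := abs_nonneg (f ((pinnedChain ω₂ lam β γ).solMap N T T w.2 w.1.1 (pairPath w.1.2)))
    calc |k ((pinnedChain ω₂ lam β γ).solMap N T T t w.1.1 (pairPath w.1.2))| *
          (|c w.2| * |f ((pinnedChain ω₂ lam β γ).solMap N T T w.2 w.1.1 (pairPath w.1.2))|)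
        ≤ |k ((pinnedChain ω₂ lam β γ).solMap N T T t w.1.1 (pairPath w.1.2))| *
          (1 * |f ((pinnedChain ω₂ lam β γ).solMap N T T w.2 w.1.1 (pairPath w.1.2))|) := by
          gcongr
      _ = _ := by ring
  have hpt : ∀ p : PhaseSpace N × WienerPair,
      k ((pinnedChain ω₂ lam β γ).solMap N T T t p.1 (pairPath p.2)) *
        (∫ s in (0 : ℝ)..t, c s * f ((pinnedChain ω₂ lam β γ).solMap N T T s p.1 (pairPath p.2))) =
      ∫ s in Ioc 0 t, k ((pinnedChain ω₂ lam β γ).solMap N T T t p.1 (pairPath p.2)) *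
        (c s * f ((pinnedChain ω₂ lam β γ).solMap N T T s p.1 (pairPath p.2))) := by
    intro p
    rw [intervalIntegral.integral_of_le ht, ← MeasureTheory.integral_const_mul]
  rw [integral_congr_ae (Eventually.of_forall hpt), integral_integral_swap hWi, ← intervalIntegral.integral_of_le ht]
  refine intervalIntegral.integral_congr fun s hs => ?_
  rw [uIcc_of_le ht] at hs
  have heq : ∫ p, k ((pinnedChain ω₂ lam β γ).solMap N T T t p.1 (pairPath p.2)) *
      (c s * f ((pinnedChain ω₂ lam β γ).solMap N T T s p.1 (pairPath p.2))) ∂(((pinnedChain ω₂ lam β γ).gibbsMeasure N T).prod wienerPair) =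
      c s * ∫ p, f ((pinnedChain ω₂ lam β γ).solMap N T T s p.1 (pairPath p.2)) *
        k ((pinnedChain ω₂ lam β γ).solMap N T T t p.1 (pairPath p.2)) ∂(((pinnedChain ω₂ lam β γ).gibbsMeasure N T).prod wienerPair) := by
    rw [← MeasureTheory.integral_const_mul]
    exact integral_congr_ae (Eventually.of_forall fun p => by ring)
  rw [heq]
  unfold kpair
  rw [pinnedChain_integral_mul_solMap_of_invariant hω hl.le hβ.le hγ.le N T T _ hinv hfm hkm hf2 hk2 hs.1 hs.2]

/-- **Weighted end-point correlation, initial value**: `E[k(z_0) ∫₀ᵗ c(s) f(z_s) ds] = ∫₀ᵗ c(s) ⟪k, P_s f⟫ ds`. [folklore] -/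
theorem pinnedChain_integral_initial_mul_weightedIntegral_eq {f k : PhaseSpace N → ℝ} (hfm : Measurable f) (hkm : Measurable k)
    (hf2 : Integrable (fun y => f y ^ 2) ((pinnedChain ω₂ lam β γ).gibbsMeasure N T))
    (hk2 : Integrable (fun y => k y ^ 2) ((pinnedChain ω₂ lam β γ).gibbsMeasure N T))
    {c : ℝ → ℝ} (hc : Measurable c) (hcb : ∀ s, |c s| ≤ 1) {t : ℝ} (ht : 0 ≤ t) :
    ∫ p, k p.1 * (∫ s in (0 : ℝ)..t, c s * f ((pinnedChain ω₂ lam β γ).solMap N T T s p.1 (pairPath p.2)))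
        ∂(((pinnedChain ω₂ lam β γ).gibbsMeasure N T).prod wienerPair) =
      ∫ s in (0 : ℝ)..t, c s * kpair ω₂ lam β γ T N k f s := by
  haveI := pinnedChain_isProbabilityMeasure_gibbsMeasure hω hl.le hβ.le γ N hT
  have hinv := pinnedChain_hinv_T hω hl hβ hγ hN hT
  have hZ := pinnedChain_measurable_solMap_process hω hl.le hβ.le hγ.le N T T
  have h0 : ∀ (y : PhaseSpace N) (w' : WienerPair), (pinnedChain ω₂ lam β γ).solMap N T T 0 y w' = y :=
    fun y w' => pinnedChain_solMap_of_nonpos N T T y w' le_rfl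
  have hWi := (pinnedChain_integrable_uncurry_pointTime_of_invariant hω hl.le hβ.le hγ.le N T T _ hinv hfm hkm hf2 hk2 0 t)
  have hWm : Measurable (Function.uncurry fun (p : PhaseSpace N × WienerPair) (s : ℝ) =>
      k p.1 * (c s * f ((pinnedChain ω₂ lam β γ).solMap N T T s p.1 (pairPath p.2)))) := by
    have h2 : Measurable fun w : (PhaseSpace N × WienerPair) × ℝ => (w.2, w.1) := measurable_snd.prodMk measurable_fst
    have hA : Measurable fun w : (PhaseSpace N × WienerPair) × ℝ => k w.1.1 := hkm.comp (measurable_fst.comp measurable_fst)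
    have hB := hfm.comp (hZ.comp h2)
    have hc' : Measurable fun w : (PhaseSpace N × WienerPair) × ℝ => c w.2 := hc.comp measurable_snd
    exact hA.mul (hc'.mul hB)
  have hWi' : Integrable (Function.uncurry fun (p : PhaseSpace N × WienerPair) (s : ℝ) =>
      k p.1 * (c s * f ((pinnedChain ω₂ lam β γ).solMap N T T s p.1 (pairPath p.2))))
      ((((pinnedChain ω₂ lam β γ).gibbsMeasure N T).prod wienerPair).prod ((volume : Measure ℝ).restrict (Ioc 0 t))) := by
    refine hWi.mono hWm.aestronglyMeasurable (Eventually.of_forall fun w => ?_)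
    simp only [Function.uncurry, Real.norm_eq_abs, abs_mul, h0]
    have h1 := hcb w.2
    have hA := abs_nonneg (k w.1.1)
    have hB := abs_nonneg (f ((pinnedChain ω₂ lam β γ).solMap N T T w.2 w.1.1 (pairPath w.1.2)))
    calc |k w.1.1| * (|c w.2| * |f ((pinnedChain ω₂ lam β γ).solMap N T T w.2 w.1.1 (pairPath w.1.2))|)
        ≤ |k w.1.1| * (1 * |f ((pinnedChain ω₂ lam β γ).solMap N T T w.2 w.1.1 (pairPath w.1.2))|) := by
          gcongr
      _ = _ := by ring
  have hpt : ∀ p : PhaseSpace N × WienerPair,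
      k p.1 * (∫ s in (0 : ℝ)..t, c s * f ((pinnedChain ω₂ lam β γ).solMap N T T s p.1 (pairPath p.2))) =
      ∫ s in Ioc 0 t, k p.1 * (c s * f ((pinnedChain ω₂ lam β γ).solMap N T T s p.1 (pairPath p.2))) := by
    intro p
    rw [intervalIntegral.integral_of_le ht, ← MeasureTheory.integral_const_mul]
  rw [integral_congr_ae (Eventually.of_forall hpt), integral_integral_swap hWi', ← intervalIntegral.integral_of_le ht]
  refine intervalIntegral.integral_congr fun s hs => ?_
  rw [uIcc_of_le ht] at hs
  have heq : ∫ p, k p.1 * (c s * f ((pinnedChain ω₂ lam β γ).solMap N T T s p.1 (pairPath p.2)))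
      ∂(((pinnedChain ω₂ lam β γ).gibbsMeasure N T).prod wienerPair) =
      c s * ∫ p, k ((pinnedChain ω₂ lam β γ).solMap N T T 0 p.1 (pairPath p.2)) *
        f ((pinnedChain ω₂ lam β γ).solMap N T T s p.1 (pairPath p.2)) ∂(((pinnedChain ω₂ lam β γ).gibbsMeasure N T).prod wienerPair) := by
    rw [← MeasureTheory.integral_const_mul]
    exact integral_congr_ae (Eventually.of_forall fun p => by simp only [h0]; ring)
  have h1 := pinnedChain_integral_mul_solMap_of_invariant hω hl.le hβ.le hγ.le N T T _ hinv hkm hfm hk2 hf2 le_rfl hs.1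
  rw [sub_zero] at h1
  rw [heq, h1]
  unfold kpair
  rfl

end PathMoments

/-! ## §T3 Expansion of the twisted square into fifteen path moments -/

/-- Expansion of `∫ (A + ωC + (c_w E − E₀))² + (B − ωD + s_w E)²` into fifteen path moments. [formal bookkeeping] -/
theorem integral_twist_sq_expand {Ω : Type*} [MeasurableSpace Ω] {ν : Measure Ω} {A B C D E E₀ : Ω → ℝ} (ω cw sw : ℝ)
    (hAA : Integrable (fun p => A p ^ 2) ν) (hBB : Integrable (fun p => B p ^ 2) ν) (hCC : Integrable (fun p => C p ^ 2) ν)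
    (hDD : Integrable (fun p => D p ^ 2) ν) (hAC : Integrable (fun p => A p * C p) ν) (hBD : Integrable (fun p => B p * D p) ν)
    (hEA : Integrable (fun p => E p * A p) ν) (hEC : Integrable (fun p => E p * C p) ν)
    (hE₀A : Integrable (fun p => E₀ p * A p) ν) (hE₀C : Integrable (fun p => E₀ p * C p) ν)
    (hEB : Integrable (fun p => E p * B p) ν) (hED : Integrable (fun p => E p * D p) ν) (hEE : Integrable (fun p => E p ^ 2) ν)
    (hE₀E : Integrable (fun p => E₀ p * E p) ν) (hE₀E₀ : Integrable (fun p => E₀ p ^ 2) ν) :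
    ∫ p, ((A p + ω * C p + (cw * E p - E₀ p)) ^ 2 + (B p - ω * D p + sw * E p) ^ 2) ∂ν =
      (∫ p, A p ^ 2 ∂ν) + (∫ p, B p ^ 2 ∂ν) + ω ^ 2 * ((∫ p, D p ^ 2 ∂ν) + ∫ p, C p ^ 2 ∂ν) +
        2 * ω * ((∫ p, A p * C p ∂ν) - ∫ p, B p * D p ∂ν) + 2 * cw * (∫ p, E p * A p ∂ν) + 2 * ω * cw * (∫ p, E p * C p ∂ν) -
        2 * (∫ p, E₀ p * A p ∂ν) - 2 * ω * (∫ p, E₀ p * C p ∂ν) + 2 * sw * (∫ p, E p * B p ∂ν) - 2 * ω * sw * (∫ p, E p * D p ∂ν) +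
        (cw ^ 2 + sw ^ 2) * (∫ p, E p ^ 2 ∂ν) - 2 * cw * (∫ p, E₀ p * E p ∂ν) + ∫ p, E₀ p ^ 2 ∂ν := by
  have h : ∀ p, (A p + ω * C p + (cw * E p - E₀ p)) ^ 2 + (B p - ω * D p + sw * E p) ^ 2 =
      (1) * (A p ^ 2) + (1) * (B p ^ 2) + (ω ^ 2) * (C p ^ 2) + (ω ^ 2) * (D p ^ 2) + (2 * ω) * (A p * C p) +
      (-(2 * ω)) * (B p * D p) + (2 * cw) * (E p * A p) + (2 * ω * cw) * (E p * C p) + (-2) * (E₀ p * A p) +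
      (-(2 * ω)) * (E₀ p * C p) + (2 * sw) * (E p * B p) + (-(2 * ω * sw)) * (E p * D p) + (cw ^ 2 + sw ^ 2) * (E p ^ 2) +
      (-(2 * cw)) * (E₀ p * E p) + (1) * (E₀ p ^ 2) := fun p => by ring
  have i1 : Integrable (fun p => (1) * (A p ^ 2)) ν := hAA.const_mul _
  have i2 : Integrable (fun p => (1) * (B p ^ 2)) ν := hBB.const_mul _
  have i3 : Integrable (fun p => (ω ^ 2) * (C p ^ 2)) ν := hCC.const_mul _
  have i4 : Integrable (fun p => (ω ^ 2) * (D p ^ 2)) ν := hDD.const_mul _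
  have i5 : Integrable (fun p => (2 * ω) * (A p * C p)) ν := hAC.const_mul _
  have i6 : Integrable (fun p => (-(2 * ω)) * (B p * D p)) ν := hBD.const_mul _
  have i7 : Integrable (fun p => (2 * cw) * (E p * A p)) ν := hEA.const_mul _
  have i8 : Integrable (fun p => (2 * ω * cw) * (E p * C p)) ν := hEC.const_mul _
  have i9 : Integrable (fun p => (-2) * (E₀ p * A p)) ν := hE₀A.const_mul _
  have i10 : Integrable (fun p => (-(2 * ω)) * (E₀ p * C p)) ν := hE₀C.const_mul _
  have i11 : Integrable (fun p => (2 * sw) * (E p * B p)) ν := hEB.const_mul _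
  have i12 : Integrable (fun p => (-(2 * ω * sw)) * (E p * D p)) ν := hED.const_mul _
  have i13 : Integrable (fun p => (cw ^ 2 + sw ^ 2) * (E p ^ 2)) ν := hEE.const_mul _
  have i14 : Integrable (fun p => (-(2 * cw)) * (E₀ p * E p)) ν := hE₀E.const_mul _
  have i15 : Integrable (fun p => (1) * (E₀ p ^ 2)) ν := hE₀E₀.const_mul _
  have s1 : Integrable (fun p => (1) * (A p ^ 2)) ν := i1
  have s2 : Integrable (fun p =>
      (1) * (A p ^ 2) + (1) * (B p ^ 2)) ν := s1.add i2
  have s3 : Integrable (fun p =>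
      (1) * (A p ^ 2) + (1) * (B p ^ 2) + (ω ^ 2) * (C p ^ 2)) ν := s2.add i3
  have s4 : Integrable (fun p =>
      (1) * (A p ^ 2) + (1) * (B p ^ 2) + (ω ^ 2) * (C p ^ 2) + (ω ^ 2) * (D p ^ 2)) ν := s3.add i4
  have s5 : Integrable (fun p =>
      (1) * (A p ^ 2) + (1) * (B p ^ 2) + (ω ^ 2) * (C p ^ 2) + (ω ^ 2) * (D p ^ 2) + (2 * ω) * (A p * C p)) ν := s4.add i5
  have s6 : Integrable (fun p =>
      (1) * (A p ^ 2) + (1) * (B p ^ 2) + (ω ^ 2) * (C p ^ 2) + (ω ^ 2) * (D p ^ 2) + (2 * ω) * (A p * C p) +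
      (-(2 * ω)) * (B p * D p)) ν := s5.add i6
  have s7 : Integrable (fun p =>
      (1) * (A p ^ 2) + (1) * (B p ^ 2) + (ω ^ 2) * (C p ^ 2) + (ω ^ 2) * (D p ^ 2) + (2 * ω) * (A p * C p) +
      (-(2 * ω)) * (B p * D p) + (2 * cw) * (E p * A p)) ν := s6.add i7
  have s8 : Integrable (fun p =>
      (1) * (A p ^ 2) + (1) * (B p ^ 2) + (ω ^ 2) * (C p ^ 2) + (ω ^ 2) * (D p ^ 2) + (2 * ω) * (A p * C p) +
      (-(2 * ω)) * (B p * D p) + (2 * cw) * (E p * A p) + (2 * ω * cw) * (E p * C p)) ν := s7.add i8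
  have s9 : Integrable (fun p =>
      (1) * (A p ^ 2) + (1) * (B p ^ 2) + (ω ^ 2) * (C p ^ 2) + (ω ^ 2) * (D p ^ 2) + (2 * ω) * (A p * C p) +
      (-(2 * ω)) * (B p * D p) + (2 * cw) * (E p * A p) + (2 * ω * cw) * (E p * C p) + (-2) * (E₀ p * A p)) ν := s8.add i9
  have s10 : Integrable (fun p =>
      (1) * (A p ^ 2) + (1) * (B p ^ 2) + (ω ^ 2) * (C p ^ 2) + (ω ^ 2) * (D p ^ 2) + (2 * ω) * (A p * C p) +
      (-(2 * ω)) * (B p * D p) + (2 * cw) * (E p * A p) + (2 * ω * cw) * (E p * C p) + (-2) * (E₀ p * A p) +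
      (-(2 * ω)) * (E₀ p * C p)) ν := s9.add i10
  have s11 : Integrable (fun p =>
      (1) * (A p ^ 2) + (1) * (B p ^ 2) + (ω ^ 2) * (C p ^ 2) + (ω ^ 2) * (D p ^ 2) + (2 * ω) * (A p * C p) +
      (-(2 * ω)) * (B p * D p) + (2 * cw) * (E p * A p) + (2 * ω * cw) * (E p * C p) + (-2) * (E₀ p * A p) +
      (-(2 * ω)) * (E₀ p * C p) + (2 * sw) * (E p * B p)) ν := s10.add i11
  have s12 : Integrable (fun p =>
      (1) * (A p ^ 2) + (1) * (B p ^ 2) + (ω ^ 2) * (C p ^ 2) + (ω ^ 2) * (D p ^ 2) + (2 * ω) * (A p * C p) +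
      (-(2 * ω)) * (B p * D p) + (2 * cw) * (E p * A p) + (2 * ω * cw) * (E p * C p) + (-2) * (E₀ p * A p) +
      (-(2 * ω)) * (E₀ p * C p) + (2 * sw) * (E p * B p) + (-(2 * ω * sw)) * (E p * D p)) ν := s11.add i12
  have s13 : Integrable (fun p =>
      (1) * (A p ^ 2) + (1) * (B p ^ 2) + (ω ^ 2) * (C p ^ 2) + (ω ^ 2) * (D p ^ 2) + (2 * ω) * (A p * C p) +
      (-(2 * ω)) * (B p * D p) + (2 * cw) * (E p * A p) + (2 * ω * cw) * (E p * C p) + (-2) * (E₀ p * A p) +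
      (-(2 * ω)) * (E₀ p * C p) + (2 * sw) * (E p * B p) + (-(2 * ω * sw)) * (E p * D p) + (cw ^ 2 + sw ^ 2) * (E p ^ 2)) ν := s12.add i13
  have s14 : Integrable (fun p =>
      (1) * (A p ^ 2) + (1) * (B p ^ 2) + (ω ^ 2) * (C p ^ 2) + (ω ^ 2) * (D p ^ 2) + (2 * ω) * (A p * C p) +
      (-(2 * ω)) * (B p * D p) + (2 * cw) * (E p * A p) + (2 * ω * cw) * (E p * C p) + (-2) * (E₀ p * A p) +
      (-(2 * ω)) * (E₀ p * C p) + (2 * sw) * (E p * B p) + (-(2 * ω * sw)) * (E p * D p) + (cw ^ 2 + sw ^ 2) * (E p ^ 2) +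
      (-(2 * cw)) * (E₀ p * E p)) ν := s13.add i14
  rw [integral_congr_ae (Eventually.of_forall h), integral_add s14 i15, integral_add s13 i14, integral_add s12 i13, integral_add s11 i12, integral_add s10 i11, integral_add s9 i10, integral_add s8 i9, integral_add s7 i8, integral_add s6 i7, integral_add s5 i6, integral_add s4 i5, integral_add s3 i4, integral_add s2 i3, integral_add s1 i2]
  simp only [MeasureTheory.integral_const_mul]
  ring

end Summit.AtomisticToContinuum.FouriersLaw.Theorems.BoundedResponse.HeatSpreading

end
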